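import Literature.Analysis.FluidPDE.LerayHopfClassicalContinuation
import Literature.Analysis.FluidPDE.LerayHopfConcatenation
import Literature.Analysis.FluidPDE.TaoFiniteEnergyLerayHopf
import Literature.Analysis.Calculus.WhitneyExtensionProofs
import HarnessLib

/-!
# Continuation of finite-energy classical solutions under an a priori velocity bound
# ("no premature blow-up" from "no overshoot")

Analysis/FluidPDE **proofs file** (theorems only: no definitions, no named facts, no `sorry`).
The classical continuation principle for the unforced Navier–Stokes system on `ℝ³` (`ν > 0`) in the
class of finite-energy classical solutions: a smooth solution can be continued as long as an
a priori bound on a controlling norm is available — here the endpoint Serrin norm `L^∞_t L^∞_x`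
(Robinson–Rodrigo–Sadowski 2016, Lemma 8.16 / Thm. 8.17 with `r = 2`, `s = ∞`: "blowup at time
`T` is impossible" for a Leray–Hopf solution in a Serrin class; Leray 1934, §33; the maximal-time
argument of the proof of RRS Thm. 12.3, p. 170: "It suffices to show that the solution can be
continued past the time `t = T`"). Main result:

* `exists_classical_extension_Icc_of_apriori_bound` — let `(u₀, p₀)` be a classical solution on
  the closed slab `[0, T₀] × ℝ³`, `T₀ > 0`, with finite energy `sup_t ∫ |u₀(t)|² < ∞`, let
  `T₀ ≤ T₁`, and suppose there is `M` such that EVERY finite-energy classical continuation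
  `(u, p)` of `(u₀, p₀)` to a closed slab `[0, T'] × ℝ³`, `T' ∈ [T₀, T₁]` (classical on
  `[0, T']`, `u = u₀` and `p = p₀` on `[0, T₀]`, finite energy on `[0, T']`) satisfies
  `‖u‖ ≤ M` on `[0, T'] × ℝ³`. THEN `(u₀, p₀)` HAS a finite-energy classical continuation to
  `[0, T₁] × ℝ³` (agreeing with it on `[0, T₀]`, velocity AND pressure), bounded by `M`.

In words: in the finite-energy classical class, "the solution stays below the ceiling `M` for as
long as it exists (up to `T₁`)" already implies "the solution exists (and stays below `M`) up to
`T₁`" — an a priori `L^∞` bound excludes premature blow-up.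

## The proof (all inputs are theorems of the tree)

0. **Scaffold.** A finite-energy classical solution on `[0, T₀]` is Leray–Hopf on `[0, T₀)`
   (`isLerayHopfOn_of_finiteEnergy`, Tao 2013 Lemma 8.1), hence agrees on `[0, T₀]` with a GLOBAL
   Leray–Hopf weak solution `w` from `u₀(0)` (Leray's existence theorem from the final slice and
   concatenation, `IsLerayHopfOn.concat` + `leray_existence_R3_holds`; re-proved here as
   `IsLerayHopfOn.exists_isGlobalLerayHopf_extension_le` with agreement at ALL `t ≤ T₀`).
1. **Representatives.** Consider the right ends `β ∈ [T₀, T₁ + 1]` of classical representatives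
   `(V, P)` of `w` on `[0, β)` (`w(t) = V(t)` a.e. for every `t < β`); `T₀` is one, let `β₀` be
   their supremum. Two representatives agree pointwise on their common interval (continuous slices
   equal a.e.), so a sequence of representatives with ends `↑ β₀` glues
   (`IsClassicalNSSolutionOn.exists_glue_Ico_right`) and `β₀` is attained.
2. **No premature end.** If `β₀ ≤ T₁`, the representative on `[0, β₀)` is bounded by `M`: on every
   closed `[0, T'] ⊂ [0, β₀)` it is a finite-energy continuation of `(u₀, p₀)` (its energy is
   that of the scaffold, `IsLerayHopfOn.eEnergy_le_datum`; its pressure is matched to `p₀` on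
   `[0, T₀]` by `IsClassicalNSSolutionOn.exists_pressure_eq_on_Icc`), so the hypothesis applies.
   A bounded classical representative of a Leray–Hopf solution continues strictly past its end
   (`exists_classical_extension_of_bounded_rep`: RRS Thm. 8.17 through Leray's local regular
   solutions `leray_local_regular_H1_holds` and weak–strong uniqueness) — contradicting the
   supremum. Hence `β₀ > T₁`, and a representative on some `[0, β) ⊇ [0, T₁]` is the continuation.
3. **Pressure.** Only velocities are glued; the pressure of a continuation with the right
   velocity is corrected by a smooth function of time alone so as to coincide with `p₀` on
   `[0, T₀]`: the momentum equations give `∇P = ∇p₀` there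
   (`pressure_sub_apply_zero_eq_of_timeDerivWithin_eq`), and the smooth function
   `t ↦ p₀(t, 0) - P(t, 0)` on `[0, T₀]` extends smoothly to `ℝ` by Whitney's extension theorem
   (`WhitneyExtensionConvex_holds`, proved in the tree).

No uniqueness theorem for classical solutions is needed (the scaffold fixes the velocity class),
and no energy is exported through the continuation step (representatives inherit the scaffold's
energy).

## Why it is here

Cell `ns-blowup`, seat `ns-blowup-ecbridge-8` (literature-prover), support of the child crux
`HeredityFromTwo` of route `PalasekTowerBreakdown` (item stmt-NavierStokesRegularity-19250): its
upper half `ContinuationEnvelope` (`FluidComputer/PalasekTowerRegisterGlobalHeredity.lean`) asks a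
registered stage to CONTINUE classically with finite energy to the next readout AND to stay inside
the next ceiling; by the present theorem the first clause follows from the second ("no premature
blow-up ⇐ no overshoot"), so that half is a pure a priori `L^∞` statement. Nothing about any
particular flow is asserted here.

## Mathlib / tree search

Mathlib has no Navier–Stokes theory. Tree: `hasSmoothExtensionPast_of_bounded_holds`
(`KNSSTypeIIHolds.lean`) continues bounded Leray–Hopf classical solutions past a half-open end but
exports neither energy nor pressure; `exists_classical_extension_of_bounded_rep`
(`LerayHopfClassicalContinuation.lean`) keeps a Leray–Hopf scaffold and is the step used here;
`IsLerayHopfOn.exists_isGlobalLerayHopf_extension` (`LerayHopfConcatenation.lean`) states agreement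
on `(0, T]` only, whence the `_le` variant below. No closed-slab / a-priori-bound form existed
(`lean search 'apriori|extension_Icc|noBlowup'`).

## References

* J. C. Robinson, J. L. Rodrigo, W. Sadowski, *The Three-Dimensional Navier–Stokes Equations.
  Classical theory*, CUP 2016: Lemma 8.16, Thm. 8.17 (PDF pp. 130–131), Thms. 6.10, 6.15, proof
  of Thm. 12.3 (p. 170). [RobinsonRodrigoSadowski2016]
* J. Leray, *Sur le mouvement d'un liquide visqueux emplissant l'espace*, Acta Math. 63 (1934),
  §31 (existence), §33 (epochs of regularity). [Leray1934]
* T. Tao, *Localisation and compactness properties of the Navier–Stokes global regularity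
  problem*, Anal. PDE 6 (2013), Lemma 8.1. [Tao2011]
* H. Whitney, Trans. Amer. Math. Soc. 36 (1934), Thm. I. [Whitney1934]
* C. R. Doering, J. D. Gibbon, *Applied Analysis of the Navier–Stokes Equations*, CUP 1995, §1.2,
  (1.2.17)–(1.2.21), pp. 10–11 (the pressure is determined by the velocity up to an additive
  constant at each time). [DoeringGibbon1995]
-/

noncomputable section

open MeasureTheory Set Function Filter Topology
open scoped ENNReal NNReal ContDiff

namespace Literature.Analysis.FluidPDE

/-! ### §1 Matching the pressure of a continuation on the initial segment -/

section Pressure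

variable {E : Type*} [NormedAddCommGroup E] [InnerProductSpace ℝ E] [FiniteDimensional ℝ E]
variable {ν : ℝ}

/-- The gradient ignores additive constants: `∇(g + c) = ∇g` (Mathlib `fderiv_add_const`).
[folklore] -/
private theorem gradient_add_const (g : E → ℝ) (c : ℝ) (x : E) :
    gradient (fun y => g y + c) x = gradient g x := by
  unfold gradient
  rw [fderiv_add_const]

/-- **Pressures are determined up to a function of time**: adding a smooth function of time alone
to the pressure of a classical solution gives a classical solution (same velocity, same force;
the gradient is unchanged, joint smoothness is preserved) — Doering–Gibbon 1995, §1.2: for a given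
instantaneous velocity field the pressure is determined "uniquely up to an additive constant"
((1.2.17)–(1.2.21)), i.e. up to a function of time alone.
[cite: DoeringGibbon1995, §1.2 eqs (1.2.17)–(1.2.21) (pp. 10–11)] -/
theorem IsClassicalNSSolutionOn.add_time_function {S : Set ℝ} {f u : ℝ → E → E} {p : ℝ → E → ℝ}
    (h : IsClassicalNSSolutionOn S ν f u p) {g : ℝ → ℝ} (hg : ContDiff ℝ ∞ g) :
    IsClassicalNSSolutionOn S ν f u (fun t x => p t x + g t) where
  smooth_velocity := h.smooth_velocity
  smooth_pressure := by
    have h1 : ContDiffOn ℝ ∞ (fun z : ℝ × E => g z.1) (S ×ˢ univ) := (hg.comp contDiff_fst).contDiffOn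
    have h2 : ContDiffOn ℝ ∞ (uncurry p) (S ×ˢ univ) := h.smooth_pressure
    exact (h2.add h1).congr fun z _ => rfl
  momentum t ht x := by
    rw [gradient_add_const]
    exact h.momentum t ht x
  divFree := h.divFree

omit [InnerProductSpace ℝ E] [FiniteDimensional ℝ E] in
/-- The restriction of a jointly smooth field to the time line through the spatial origin,
`t ↦ p(t, 0)`, is smooth on the time set (composition with `t ↦ (t, 0)`). [folklore] -/
private theorem IsSmoothSpaceTimeOn.contDiffOn_apply_zero [NormedSpace ℝ E] {F : Type*}
    [NormedAddCommGroup F] [NormedSpace ℝ F] {S : Set ℝ} {p : ℝ → E → F}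
    (h : IsSmoothSpaceTimeOn S p) : ContDiffOn ℝ ∞ (fun t => p t 0) S := by
  have h1 : ContDiffOn ℝ ∞ (fun t : ℝ => ((t, (0 : E)) : ℝ × E)) S :=
    (contDiff_id.prodMk contDiff_const).contDiffOn
  exact (ContDiffOn.comp h h1 fun t ht => mk_mem_prod ht (mem_univ _)).congr fun t _ => rfl

/-- **Matching the pressure of a continuation on the initial segment.** Let `(u₀, p₀)` be a
classical solution on `[0, T₀]`, `T₀ > 0`, and `(V, P)` a classical solution (same `ν`, same force)
on `[0, T']`, `T₀ ≤ T'`, with `V = u₀` on `[0, T₀]`. Then there is a pressure `P'` with `(V, P')`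
classical on `[0, T']` and `P' = p₀` on `[0, T₀]`: the momentum equations give `∇P(t,·) = ∇p₀(t,·)`
for `t ∈ [0, T₀]` (the one-sided time derivatives of `V` within `[0, T']` and of `u₀` within
`[0, T₀]` agree there), so `P - p₀` is a function `e(t) = P(t,0) - p₀(t,0)` of time alone on
`[0, T₀]`, smooth up to the endpoints; Whitney's extension theorem (`WhitneyExtensionConvex_holds`)
extends `-e` to a smooth `g` on `ℝ`, and `P' = P + g`. This is the classical fact that the
pressure of an incompressible flow is determined by the velocity "uniquely up to an additive
constant ... for a given instantaneous velocity field" (Doering–Gibbon 1995, §1.2, after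
(1.2.21)), here with the constants chosen smoothly in time.
[cite: DoeringGibbon1995, §1.2 eqs (1.2.17)–(1.2.21) (pp. 10–11)] -/
theorem IsClassicalNSSolutionOn.exists_pressure_eq_on_Icc {T₀ T' : ℝ} {f u₀ V : ℝ → E → E}
    {p₀ P : ℝ → E → ℝ} (h₀ : IsClassicalNSSolutionOn (Icc 0 T₀) ν f u₀ p₀)
    (hV : IsClassicalNSSolutionOn (Icc 0 T') ν f V P) (hT₀ : 0 < T₀) (hT : T₀ ≤ T')
    (heq : ∀ t ∈ Icc 0 T₀, V t = u₀ t) :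
    ∃ P' : ℝ → E → ℝ, IsClassicalNSSolutionOn (Icc 0 T') ν f V P' ∧
      ∀ t ∈ Icc 0 T₀, P' t = p₀ t := by
  have hsub : Icc 0 T₀ ⊆ Icc 0 T' := Icc_subset_Icc_right hT
  -- the correction `e(t) = p₀(t, 0) - P(t, 0)`, smooth on `[0, T₀]` up to the endpoints
  have he : ContDiffOn ℝ ∞ (fun t => p₀ t 0 - P t 0) (Icc 0 T₀) :=
    h₀.smooth_pressure.contDiffOn_apply_zero.sub
      (hV.smooth_pressure.contDiffOn_apply_zero.mono hsub)
  have hKi : (interior (Icc (0 : ℝ) T₀)).Nonempty := by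
    rw [interior_Icc]
    exact nonempty_Ioo.2 hT₀
  obtain ⟨g, hg, hge⟩ :=
    _root_.Literature.Analysis.Calculus.WhitneyExtensionConvex_holds.extension (E := ℝ) (F := ℝ)
      isClosed_Icc (convex_Icc 0 T₀) hKi he
  refine ⟨fun t x => P t x + g t, hV.add_time_function hg, fun t ht => ?_⟩
  -- the one-sided time derivatives agree on `[0, T₀]`
  have hdt : ∀ x, timeDerivWithin (Icc 0 T') V t x = timeDerivWithin (Icc 0 T₀) u₀ t x := by
    intro x
    rw [← hV.smooth_velocity.timeDerivWithin_eq_of_subset hsub (uniqueDiffOn_Icc hT₀) ht x]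
    simp only [timeDerivWithin_apply]
    exact derivWithin_congr (fun s hs => congrFun (heq s hs) x) (congrFun (heq t ht) x)
  funext x
  have hn := hV.pressure_sub_apply_zero_eq_of_timeDerivWithin_eq h₀ (hsub ht) ht (heq t ht) hdt x
  have hgt : g t = p₀ t 0 - P t 0 := hge ht
  show P t x + g t = p₀ t x
  rw [hgt]
  linarith

end Pressure

/-! ### §2 The Leray–Hopf scaffold -/

section Scaffold

variable {ν T : ℝ} {u₀ : EuclideanSpace ℝ (Fin 3) → EuclideanSpace ℝ (Fin 3)}
  {u : ℝ → EuclideanSpace ℝ (Fin 3) → EuclideanSpace ℝ (Fin 3)}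

/-- **Global continuation of Leray–Hopf solutions, agreement up to the initial time.** Every
Leray–Hopf weak solution `u` of the unforced system (`ν > 0`) on `ℝ³ × [0, T)`, `T > 0`, agrees
at ALL times `t ≤ T` (in particular at `t = 0`) with a global Leray–Hopf weak solution from the
same datum — the tree's `IsLerayHopfOn.exists_isGlobalLerayHopf_extension` (Leray's existence theorem
from the final slice `u(T)` and concatenation), whose statement records the agreement on `(0, T]`
only; same construction. [cite: Leray1934, §31] -/
theorem IsLerayHopfOn.exists_isGlobalLerayHopf_extension_le (hν : 0 < ν) (hT : 0 < T)
    (hu : IsLerayHopfOn T ν 0 u₀ u) :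
    ∃ w : ℝ → EuclideanSpace ℝ (Fin 3) → EuclideanSpace ℝ (Fin 3),
      IsGlobalLerayHopf ν 0 u₀ w ∧ ∀ t ≤ T, w t = u t := by
  have hmemT : MemLp (u T) 2 volume := hu.memLp T ⟨hT.le, le_rfl⟩
  have hdivT : IsWeaklyDivFree (u T) := hu.isWeaklyDivFree_final hT
  obtain ⟨w, hw⟩ := leray_existence_R3_holds ν hν (u T) hmemT hdivT
  refine ⟨fun t => if t ≤ T then u t else w (t - T), fun T' hT' => ?_, fun t ht => if_pos ht⟩
  exact (hu.concat hν.le hT hT' (hw T' hT')).of_le (by linarith)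

/-- Two classical representatives of the same field agree pointwise at a common time: continuous
slices equal almost everywhere to the same slice are equal. [folklore] -/
private theorem IsClassicalNSSolutionOn.rep_eq {S₁ S₂ : Set ℝ} {ν' : ℝ}
    {f V₁ V₂ : ℝ → EuclideanSpace ℝ (Fin 3) → EuclideanSpace ℝ (Fin 3)}
    {P₁ P₂ : ℝ → EuclideanSpace ℝ (Fin 3) → ℝ}
    {w : ℝ → EuclideanSpace ℝ (Fin 3) → EuclideanSpace ℝ (Fin 3)}
    (h₁ : IsClassicalNSSolutionOn S₁ ν' f V₁ P₁) (h₂ : IsClassicalNSSolutionOn S₂ ν' f V₂ P₂)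
    {t : ℝ} (ht₁ : t ∈ S₁) (ht₂ : t ∈ S₂) (hw₁ : w t =ᵐ[volume] V₁ t)
    (hw₂ : w t =ᵐ[volume] V₂ t) : V₁ t = V₂ t :=
  (Continuous.ae_eq_iff_eq volume (h₁.contDiff_velocity ht₁).continuous
    (h₂.contDiff_velocity ht₂).continuous).1 (hw₁.symm.trans hw₂)

end Scaffold

/-! ### §3 The continuation principle -/

section Main

/-- **Continuation of finite-energy classical solutions under an a priori velocity bound** ("no
premature blow-up" from "no overshoot"; Robinson–Rodrigo–Sadowski 2016, Lemma 8.16 / Thm. 8.17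
with `r = 2`, `s = ∞`, and the maximal-time argument of the proof of Thm. 12.3; Leray 1934, §33).
Unforced Navier–Stokes on `ℝ³`, `ν > 0`. Let `(u₀, p₀)` be a classical solution on `[0, T₀]`,
`0 < T₀ ≤ T₁`, with finite energy `sup_{[0,T₀]} ∫|u₀(t)|² < ∞`, and let `M` be such that every
finite-energy classical continuation `(u, p)` of `(u₀, p₀)` to a slab `[0, T']`, `T' ∈ [T₀, T₁]`
— `(u, p)` classical on `[0, T']`, `u = u₀` and `p = p₀` on `[0, T₀]`, `sup_{[0,T']} ∫|u(t)|² < ∞` —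
satisfies `‖u(t, x)‖ ≤ M` on `[0, T'] × ℝ³`. Then there IS a finite-energy classical continuation
`(u, p)` of `(u₀, p₀)` to `[0, T₁]`, and it is bounded by `M`. See the module docstring for the
proof (Leray–Hopf scaffold, supremum of the ends of classical representatives, continuation of
bounded representatives `exists_classical_extension_of_bounded_rep`, pressure matching
`exists_pressure_eq_on_Icc`).
[cite: RobinsonRodrigoSadowski2016, Lemma 8.16 and Thm 8.17 (r = 2, s = ∞; PDF pp. 130–131) with the proof of Thm 12.3 (p. 170)] -/
theorem exists_classical_extension_Icc_of_apriori_bound {ν T₀ T₁ M : ℝ}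
    {u₀ : ℝ → EuclideanSpace ℝ (Fin 3) → EuclideanSpace ℝ (Fin 3)}
    {p₀ : ℝ → EuclideanSpace ℝ (Fin 3) → ℝ}
    (hν : 0 < ν) (hT₀ : 0 < T₀) (hT₀₁ : T₀ ≤ T₁)
    (hcl : IsClassicalNSSolutionOn (Icc 0 T₀) ν 0 u₀ p₀)
    (hfe : ∃ A : ℝ≥0∞, A < ⊤ ∧ ∀ t ∈ Icc 0 T₀, ∫⁻ x, ‖u₀ t x‖ₑ ^ 2 ≤ A)
    (hM : ∀ T' ∈ Icc T₀ T₁,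
      ∀ (u : ℝ → EuclideanSpace ℝ (Fin 3) → EuclideanSpace ℝ (Fin 3))
        (p : ℝ → EuclideanSpace ℝ (Fin 3) → ℝ),
        IsClassicalNSSolutionOn (Icc 0 T') ν 0 u p →
        (∀ t ∈ Icc 0 T₀, u t = u₀ t ∧ p t = p₀ t) →
        (∃ A : ℝ≥0∞, A < ⊤ ∧ ∀ t ∈ Icc 0 T', ∫⁻ x, ‖u t x‖ₑ ^ 2 ≤ A) →
        ∀ t ∈ Icc 0 T', ∀ x, ‖u t x‖ ≤ M) :
    ∃ (u : ℝ → EuclideanSpace ℝ (Fin 3) → EuclideanSpace ℝ (Fin 3))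
      (p : ℝ → EuclideanSpace ℝ (Fin 3) → ℝ),
      IsClassicalNSSolutionOn (Icc 0 T₁) ν 0 u p ∧
      (∀ t ∈ Icc 0 T₀, u t = u₀ t ∧ p t = p₀ t) ∧
      (∃ A : ℝ≥0∞, A < ⊤ ∧ ∀ t ∈ Icc 0 T₁, ∫⁻ x, ‖u t x‖ₑ ^ 2 ≤ A) ∧
      ∀ t ∈ Icc 0 T₁, ∀ x, ‖u t x‖ ≤ M := by
  -- §0 the Leray–Hopf scaffold `w`: global, `w = u₀` at all times `t ≤ T₀`
  obtain ⟨hLH₀, -⟩ := isLerayHopfOn_of_finiteEnergy hcl hν hT₀ hfe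
  obtain ⟨w, hwG, hwu⟩ := hLH₀.exists_isGlobalLerayHopf_extension_le hν hT₀
  set T : ℝ := T₁ + 2 with hTdef
  have hT : 0 < T := by linarith
  have hLH : IsLerayHopfOn T ν 0 (u₀ 0) w := hwG T hT
  -- the energy of the scaffold
  set A : ℝ≥0∞ := ENNReal.ofReal (2 * VectorCalculus.kineticEnergy (u₀ 0)) with hAdef
  have hAtop : A < ⊤ := ENNReal.ofReal_lt_top
  have hAw : ∀ t ∈ Icc 0 T, ∫⁻ x, ‖w t x‖ₑ ^ 2 ≤ A := fun t ht => hLH.eEnergy_le_datum hν.le ht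
  -- classical representatives of `w` agree with `u₀` on `[0, T₀]`
  have hvel : ∀ {β : ℝ} {V : ℝ → EuclideanSpace ℝ (Fin 3) → EuclideanSpace ℝ (Fin 3)}
      {P : ℝ → EuclideanSpace ℝ (Fin 3) → ℝ}, IsClassicalNSSolutionOn (Ico 0 β) ν 0 V P →
      (∀ t ∈ Ico 0 β, w t =ᵐ[volume] V t) → ∀ t ∈ Ico 0 β, t ≤ T₀ → V t = u₀ t := by
    intro β V P hV hrep t htβ htT₀
    have ht : t ∈ Icc 0 T₀ := ⟨htβ.1, htT₀⟩
    have h1 : w t =ᵐ[volume] u₀ t := (hwu t htT₀).eventuallyEq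
    exact hV.rep_eq hcl htβ ht (hrep t htβ) h1
  -- a representative on `[0, β)`, `β > T' ≥ T₀`, `T' ≤ T₁`, restricts to a good continuation on
  -- `[0, T']`: classical, agreeing with `(u₀, p₀)` after matching the pressure, with the
  -- scaffold's energy, hence bounded by `M`
  have good : ∀ (β T' : ℝ), T' < β → T₀ ≤ T' → T' ≤ T₁ →
      ∀ (V : ℝ → EuclideanSpace ℝ (Fin 3) → EuclideanSpace ℝ (Fin 3))
        (P : ℝ → EuclideanSpace ℝ (Fin 3) → ℝ),
        IsClassicalNSSolutionOn (Ico 0 β) ν 0 V P → (∀ t ∈ Ico 0 β, w t =ᵐ[volume] V t) →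
        ∃ P' : ℝ → EuclideanSpace ℝ (Fin 3) → ℝ,
          IsClassicalNSSolutionOn (Icc 0 T') ν 0 V P' ∧
          (∀ t ∈ Icc 0 T₀, V t = u₀ t ∧ P' t = p₀ t) ∧
          (∃ A : ℝ≥0∞, A < ⊤ ∧ ∀ t ∈ Icc 0 T', ∫⁻ x, ‖V t x‖ₑ ^ 2 ≤ A) ∧
          ∀ t ∈ Icc 0 T', ∀ x, ‖V t x‖ ≤ M := by
    intro β T' hT'β hT₀' hT'₁ V P hV hrep
    have hT'pos : 0 < T' := hT₀.trans_le hT₀'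
    have hVc : IsClassicalNSSolutionOn (Icc 0 T') ν 0 V P :=
      hV.mono (Icc_subset_Ico_right hT'β) (uniqueDiffOn_Icc hT'pos)
    have hVu : ∀ t ∈ Icc 0 T₀, V t = u₀ t := fun t ht =>
      hvel hV hrep t ⟨ht.1, (ht.2.trans hT₀').trans_lt hT'β⟩ ht.2
    obtain ⟨P', hVP', hP'⟩ := hcl.exists_pressure_eq_on_Icc hVc hT₀ hT₀' hVu
    have hagree : ∀ t ∈ Icc 0 T₀, V t = u₀ t ∧ P' t = p₀ t := fun t ht => ⟨hVu t ht, hP' t ht⟩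
    have hfeV : ∃ A : ℝ≥0∞, A < ⊤ ∧ ∀ t ∈ Icc 0 T', ∫⁻ x, ‖V t x‖ₑ ^ 2 ≤ A := by
      refine ⟨A, hAtop, fun t ht => ?_⟩
      have htβ : t ∈ Ico 0 β := ⟨ht.1, ht.2.trans_lt hT'β⟩
      have htT : t ∈ Icc 0 T := ⟨ht.1, by linarith [ht.2]⟩
      calc ∫⁻ x, ‖V t x‖ₑ ^ 2 = ∫⁻ x, ‖w t x‖ₑ ^ 2 :=
            lintegral_congr_ae ((hrep t htβ).mono fun x hx => by
              show ‖V t x‖ₑ ^ 2 = ‖w t x‖ₑ ^ 2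
              rw [hx])
        _ ≤ A := hAw t htT
    exact ⟨P', hVP', hagree, hfeV, hM T' ⟨hT₀', hT'₁⟩ V P' hVP' hagree hfeV⟩
  -- §1 the right ends of classical representatives of `w`
  set 𝒯 : Set ℝ := {β | T₀ ≤ β ∧ β ≤ T₁ + 1 ∧
      ∃ (V : ℝ → EuclideanSpace ℝ (Fin 3) → EuclideanSpace ℝ (Fin 3))
        (P : ℝ → EuclideanSpace ℝ (Fin 3) → ℝ),
        IsClassicalNSSolutionOn (Ico 0 β) ν 0 V P ∧ ∀ t ∈ Ico 0 β, w t =ᵐ[volume] V t} with h𝒯def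
  have hT₀mem : T₀ ∈ 𝒯 := by
    refine ⟨le_rfl, by linarith, u₀, p₀, hcl.mono Ico_subset_Icc_self (uniqueDiffOn_Ico 0 T₀),
      fun t ht => ?_⟩
    exact (hwu t ht.2.le).eventuallyEq
  have hbdd : BddAbove 𝒯 := ⟨T₁ + 1, fun β hβ => hβ.2.1⟩
  have hne : 𝒯.Nonempty := ⟨T₀, hT₀mem⟩
  set β₀ : ℝ := sSup 𝒯 with hβ₀def
  have hT₀β₀ : T₀ ≤ β₀ := le_csSup hbdd hT₀mem
  have hβ₀le : β₀ ≤ T₁ + 1 := csSup_le hne fun β hβ => hβ.2.1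
  have hβ₀pos : 0 < β₀ := hT₀.trans_le hT₀β₀
  -- §2 the supremum is attained: glue a sequence of representatives with ends `↑ β₀`
  have hmem : β₀ ∈ 𝒯 := by
    have hex : ∀ n : ℕ, ∃ β ∈ 𝒯, β₀ - 1 / ((n : ℝ) + 1) < β := fun n =>
      exists_lt_of_lt_csSup hne (by
        have hn : (0 : ℝ) < 1 / ((n : ℝ) + 1) := by positivity
        linarith)
    choose b hb𝒯 hblt using hex
    have hbβ : ∀ n, b n ≤ β₀ := fun n => le_csSup hbdd (hb𝒯 n)
    choose V P hV hrep using fun n => (hb𝒯 n).2.2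
    have hb : ∀ t, t < β₀ → ∃ n, t < b n := by
      intro t ht
      obtain ⟨n, hn⟩ := exists_nat_one_div_lt (sub_pos.2 ht)
      exact ⟨n, by linarith [hblt n]⟩
    have hagree : ∀ m n, ∀ t ∈ Ico 0 (min (b m) (b n)), V m t = V n t := by
      intro m n t ht
      have htm : t ∈ Ico 0 (b m) := ⟨ht.1, ht.2.trans_le (min_le_left _ _)⟩
      have htn : t ∈ Ico 0 (b n) := ⟨ht.1, ht.2.trans_le (min_le_right _ _)⟩
      exact (hV m).rep_eq (hV n) htm htn (hrep m t htm) (hrep n t htn)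
    obtain ⟨v, q, hv, hvV⟩ :=
      IsClassicalNSSolutionOn.exists_glue_Ico_right (a := 0) hbβ hb hV hagree
    refine ⟨hT₀β₀, hβ₀le, v, q, hv, fun t ht => ?_⟩
    obtain ⟨n, hn⟩ := hb t ht.2
    rw [hvV n t ⟨ht.1, hn⟩]
    exact hrep n t ⟨ht.1, hn⟩
  -- §3 no premature end: `β₀ > T₁`
  have hβ₀T₁ : T₁ < β₀ := by
    by_contra hle
    push Not at hle
    obtain ⟨-, -, V, P, hV, hrep⟩ := hmem
    -- the representative on `[0, β₀)` is bounded by `M`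
    have hbd : ∀ t ∈ Ico 0 β₀, ∀ x, ‖V t x‖ ≤ M := by
      intro t ht x
      rcases lt_or_ge t T₀ with htT₀ | htT₀
      · -- on `[0, T₀)`: `V = u₀`, bounded by the hypothesis at `T' = T₀`
        have ht' : t ∈ Icc 0 T₀ := ⟨ht.1, htT₀.le⟩
        rw [hvel hV hrep t ht htT₀.le]
        exact hM T₀ ⟨le_rfl, hT₀₁⟩ u₀ p₀ hcl (fun s _ => ⟨rfl, rfl⟩) hfe t ht' x
      · -- on `[T₀, β₀)`: restrict to `[0, T']`, `T' = (t + β₀)/2`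
        have h1 : (t + β₀) / 2 < β₀ := by linarith [ht.2]
        have h2 : T₀ ≤ (t + β₀) / 2 := by linarith
        have h3 : (t + β₀) / 2 ≤ T₁ := by linarith
        have h4 : t ≤ (t + β₀) / 2 := by linarith [ht.2]
        obtain ⟨P', -, -, -, hbdT'⟩ := good β₀ ((t + β₀) / 2) h1 h2 h3 V P hV hrep
        exact hbdT' t ⟨ht.1, h4⟩ x
    -- hence it continues strictly past `β₀` as a representative of the scaffold
    obtain ⟨b, hβ₀b, V', P', hV', -, hrep', -⟩ :=
      exists_classical_extension_of_bounded_rep hν hLH hβ₀pos (by linarith) hV hrep hbd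
    have hβ'β₀ : β₀ < min b (T₁ + 1) := lt_min hβ₀b (by linarith)
    have hβ'mem : min b (T₁ + 1) ∈ 𝒯 := by
      refine ⟨hT₀β₀.trans hβ'β₀.le, min_le_right _ _, V', P',
        hV'.mono (Ico_subset_Ico_right (min_le_left _ _)) (uniqueDiffOn_Ico 0 _), fun t ht => ?_⟩
      have htb : t < b := ht.2.trans_le (min_le_left _ _)
      have htT : t < T := by
        have := ht.2.trans_le (min_le_right b (T₁ + 1))
        linarith
      exact hrep' t ⟨ht.1, lt_min htb htT⟩
    exact absurd (le_csSup hbdd hβ'mem) (not_le.2 hβ'β₀)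
  -- §4 a representative on `[0, β) ⊇ [0, T₁]` is the continuation
  obtain ⟨β, hβmem, hT₁β⟩ := exists_lt_of_lt_csSup hne hβ₀T₁
  obtain ⟨-, -, V, P, hV, hrep⟩ := hβmem
  obtain ⟨P', hVP', hagree, hfeV, hbd⟩ := good β T₁ hT₁β hT₀₁ le_rfl V P hV hrep
  exact ⟨V, P', hVP', hagree, hfeV, hbd⟩

end Main

end Literature.Analysis.FluidPDE

end
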